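import Mathlib
import Summits.NavierStokesRegularity.NavierStokesRegularity.Theorems.SubOnsagerCeilingSideBranchDynamics
import HarnessLib

/-!
# Route SubOnsagerCeiling — the CAPTURE LAW of `α_SB`: a pocket plus its side mode never hold more than
# `(4·e^{ν_{k+1}t}·(Λ_k/5)∫₀ᵗ x_k⁴)^{2/3}` (true dynamics, no sign condition, no ceiling)
# (helper file for item stmt-NavierStokesRegularity-25507 `OrthantTailCeiling`; `--supports`; def-free)

First brick of «R-A» = the UNIFORM PARKING BOUND to which the conditional refutations of the aside cruxes
`OrthantTailCeiling` (stmt-25507) / `ForwardTailCeiling` (stmt-26608) on the side-branch dead-end table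
`α_SB = sideBranchTable` are now reduced (`sideBranchCeilingEscapeAt_of_parkingBound`, this lineage): the
first `K+1` dead-end pockets must never hold more than `(1 − q)E₀`.  The numerical refutation of record
rests on the scaling law «`z³ ≍ Λ_k∫x_k⁴`» for the pocket fed through a choked side mode
(`Cruxes/OrthantTailCeiling/REFUTATION-EVIDENCE.md` §3).  This file proves that law as a RIGOROUS UPPER
BOUND on capture, along ANY regular solution (no non-negativity, no ceiling, any `ν ≥ 0`):

* `sideBranch_capture_family` — for every `ε > 0` and `t ∈ [0,s]`:
  `s_k(t)² + z_{k+1}(t)² ≤ s_k(0)² + z_{k+1}(0)² + (1/ε)·(Λ_k/5)∫₀ᵗ x_k⁴ + ε·(Λ_k/5)∫₀ᵗ s_k²`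
  (`d/dt(s_k² + z_{k+1}²) = 2(Λ_k/5)x_k²s_k − 2ν_ks_k² − 2ν_{k+1}z_{k+1}² ≤ (Λ_k/5)(x_k⁴/ε + εs_k²)`: the
  side pump is the only source of the pair, and the pocket drain `−(Λ_k/5)s_k z_{k+1}·s_k` is exactly
  compensated by the pocket gain — the pair's energy is fed by `x_k²s_k` alone);
* `sideBranch_capture_eps` — with empty side mode and pocket at time `0`, using the pocket meter
  `(Λ_k/5)∫₀ᵗ s_k² ≤ e^{ν_{k+1}t} z_{k+1}(t)` (p619653) and `z_{k+1} ≤ √(s_k² + z_{k+1}²)`: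
  `Y ≤ A/ε + ε·e^{ν_{k+1}t}·√Y`, `Y = s_k(t)² + z_{k+1}(t)²`, `A = (Λ_k/5)∫₀ᵗ x_k⁴`;
* **`sideBranch_capture_law`** — optimising `ε`: **`Y·√Y ≤ 4·e^{ν_{k+1}t}·(Λ_k/5)∫₀ᵗ x_k⁴`**, i.e. the
  energy parked in the pocket `z_{k+1}` plus the energy still in the side mode `s_k` is at most
  `½(4e^{ν_{k+1}t}(Λ_k/5)∫₀ᵗx_k⁴)^{2/3}` — the FOURTH-MOMENT OCCUPATION of the chain mode controls the
  capture, with the sub-linear exponent `2/3` of the numerics.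

Consequence for the programme (not formalised here): total parking `Σ_k ½z_{k+1}² ≤ 2^{1/3} Σ_k
(e^{ν_{k+1}T}(Λ_k/5)∫₀ᵀ x_k⁴)^{2/3}`, so the parking bound follows from a SUB-KOLMOGOROV FOURTH-MOMENT
OCCUPATION bound for the chain of `α_SB` — `Σ_k (Λ_k∫₀ᵀx_k⁴)^{2/3} < 5^{2/3}2^{-1/3}(1−q)E₀` — a statement
about the chain modes only (brief fronts, weak wake).  NOT proved here.

HONEST FRAMING: elementary real analysis of a Tao-type MODEL lattice ODE (route SubOnsagerCeiling, rung
TL-M2Break); a brick toward a construction that is NOT carried out here; nothing bears on Navier–Stokes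
regularity; no crux is settled here. [cite: Tao2016AveragedNS, §4 (4.2)–(4.3)];
Katz–Pavlović couplings: [cite: BarbatoMorandinRomito2011, §2].
-/

noncomputable section

-- the sub-problem namespace `NavierStokesRegularity.NavierStokesRegularity` is the tree's layout (D-0017)
set_option linter.dupNamespace false

namespace Summit.NavierStokesRegularity.NavierStokesRegularity.Theorems.SubOnsagerCeiling

open Set MeasureTheory intervalIntegral
open Literature.Analysis.FluidPDE.TaoCascade

section Solution

variable {ε₀ ν s : ℝ} {X : Fin 4 → ℤ → ℝ → ℝ}

/-- **The capture family.** Along a regular solution of the `ν`-viscous `α_SB` lattice on `[0,s]` (`ν ≥ 0`,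
continuous modes), for every shell `k`, every `ε > 0` and every `t ∈ [0,s]`:
`s_k(t)² + z_{k+1}(t)² ≤ s_k(0)² + z_{k+1}(0)² + (1/ε)(Λ_k/5)∫₀ᵗ x_k⁴ + ε(Λ_k/5)∫₀ᵗ s_k²`.
No sign condition is used. [this file] -/
theorem sideBranch_capture_family (hε : 0 < ε₀) (hν : 0 ≤ ν)
    (hcont : ∀ (i : Fin 4) (k : ℤ), Continuous (X i k))
    (hder : ∀ (i : Fin 4) (k : ℤ), ∀ t ∈ Icc (0 : ℝ) s, HasDerivWithinAt (X i k)
      (quadTerm ε₀ sideBranchTable X i k t - ν * (1 + ε₀) ^ ((2 : ℝ) * k) * X i k t)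
      (Icc (0 : ℝ) s) t)
    (k : ℤ) {ε : ℝ} (hεp : 0 < ε) {t : ℝ} (ht : t ∈ Icc (0 : ℝ) s) :
    X 1 k t ^ 2 + X 2 (k + 1) t ^ 2 ≤ X 1 k 0 ^ 2 + X 2 (k + 1) 0 ^ 2 +
      (1 / ε) * ((1 / 5 : ℝ) * (1 + ε₀) ^ ((5 : ℝ) * k / 2) * ∫ u in (0 : ℝ)..t, X 0 k u ^ 4) +
      ε * ((1 / 5 : ℝ) * (1 + ε₀) ^ ((5 : ℝ) * k / 2) * ∫ u in (0 : ℝ)..t, X 1 k u ^ 2) := by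
  have hb : (0 : ℝ) < 1 + ε₀ := by linarith
  set L : ℝ := (1 / 5 : ℝ) * (1 + ε₀) ^ ((5 : ℝ) * k / 2) with hL
  set c₀ : ℝ := ν * (1 + ε₀) ^ ((2 : ℝ) * k) with hc₀
  set c₁ : ℝ := ν * (1 + ε₀) ^ ((2 : ℝ) * ((k + 1 : ℤ) : ℝ)) with hc₁
  have hL0 : 0 ≤ L := mul_nonneg (by norm_num) (Real.rpow_nonneg hb.le _)
  have hc₀0 : 0 ≤ c₀ := mul_nonneg hν (Real.rpow_nonneg hb.le _)
  have hc₁0 : 0 ≤ c₁ := mul_nonneg hν (Real.rpow_nonneg hb.le _)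
  -- the two equations in closed form
  have hsd : ∀ u ∈ Icc (0 : ℝ) s, HasDerivWithinAt (X 1 k)
      (L * X 0 k u ^ 2 - L * (X 1 k u * X 2 (k + 1) u) - c₀ * X 1 k u) (Icc 0 s) u := by
    intro u hu
    have h := hder 1 k u hu
    rw [sideBranch_quadTerm_one] at h
    exact h
  have hzd : ∀ u ∈ Icc (0 : ℝ) s, HasDerivWithinAt (X 2 (k + 1))
      (L * X 1 k u ^ 2 - c₁ * X 2 (k + 1) u) (Icc 0 s) u := by
    intro u hu
    have h := hder 2 (k + 1) u hu
    rw [sideBranch_quadTerm_two_succ] at h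
    exact h
  -- the comparison function
  have h4 : Continuous fun u => X 0 k u ^ 4 := (hcont 0 k).pow 4
  have h2 : Continuous fun u => X 1 k u ^ 2 := (hcont 1 k).pow 2
  set Φ : ℝ → ℝ := fun u => X 1 k u ^ 2 + X 2 (k + 1) u ^ 2 -
    (1 / ε) * (L * ∫ x in (0 : ℝ)..u, X 0 k x ^ 4) - ε * (L * ∫ x in (0 : ℝ)..u, X 1 k x ^ 2) with hΦ
  have hderΦ : ∀ u ∈ Icc (0 : ℝ) s, HasDerivWithinAt Φ
      (2 * X 1 k u * (L * X 0 k u ^ 2 - L * (X 1 k u * X 2 (k + 1) u) - c₀ * X 1 k u) +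
        2 * X 2 (k + 1) u * (L * X 1 k u ^ 2 - c₁ * X 2 (k + 1) u) -
        (1 / ε) * (L * X 0 k u ^ 4) - ε * (L * X 1 k u ^ 2)) (Icc 0 s) u := by
    intro u hu
    have hA := ((h4.integral_hasStrictDerivAt 0 u).hasDerivAt).hasDerivWithinAt (s := Icc (0 : ℝ) s)
    have hB := ((h2.integral_hasStrictDerivAt 0 u).hasDerivAt).hasDerivWithinAt (s := Icc (0 : ℝ) s)
    have hS := (hsd u hu).pow 2
    have hZ := (hzd u hu).pow 2
    have h := ((hS.add hZ).sub ((hA.const_mul L).const_mul (1 / ε))).sub ((hB.const_mul L).const_mul ε)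
    refine h.congr_deriv ?_
    simp only [Nat.cast_ofNat]
    ring
  have hle : ∀ u ∈ Icc (0 : ℝ) s,
      2 * X 1 k u * (L * X 0 k u ^ 2 - L * (X 1 k u * X 2 (k + 1) u) - c₀ * X 1 k u) +
        2 * X 2 (k + 1) u * (L * X 1 k u ^ 2 - c₁ * X 2 (k + 1) u) -
        (1 / ε) * (L * X 0 k u ^ 4) - ε * (L * X 1 k u ^ 2) ≤ 0 := by
    intro u hu
    -- `2x²s ≤ x⁴/ε + εs²`
    have hyoung : 2 * X 0 k u ^ 2 * X 1 k u ≤ (1 / ε) * X 0 k u ^ 4 + ε * X 1 k u ^ 2 := by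
      have hsq : 0 ≤ (X 0 k u ^ 2 - ε * X 1 k u) ^ 2 := sq_nonneg _
      have hid : (1 / ε) * X 0 k u ^ 4 + ε * X 1 k u ^ 2 - 2 * X 0 k u ^ 2 * X 1 k u =
          (1 / ε) * (X 0 k u ^ 2 - ε * X 1 k u) ^ 2 := by
        field_simp
        ring
      have : 0 ≤ (1 / ε) * (X 0 k u ^ 2 - ε * X 1 k u) ^ 2 := by positivity
      linarith
    have h1 : 0 ≤ c₀ * X 1 k u ^ 2 := by positivity
    have h3 : 0 ≤ c₁ * X 2 (k + 1) u ^ 2 := by positivity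
    have hid2 : 2 * X 1 k u * (L * X 0 k u ^ 2 - L * (X 1 k u * X 2 (k + 1) u) - c₀ * X 1 k u) +
        2 * X 2 (k + 1) u * (L * X 1 k u ^ 2 - c₁ * X 2 (k + 1) u) -
        (1 / ε) * (L * X 0 k u ^ 4) - ε * (L * X 1 k u ^ 2) =
        L * (2 * X 0 k u ^ 2 * X 1 k u - ((1 / ε) * X 0 k u ^ 4 + ε * X 1 k u ^ 2)) -
          2 * (c₀ * X 1 k u ^ 2) - 2 * (c₁ * X 2 (k + 1) u ^ 2) := by ring
    rw [hid2]
    have h5 : L * (2 * X 0 k u ^ 2 * X 1 k u - ((1 / ε) * X 0 k u ^ 4 + ε * X 1 k u ^ 2)) ≤ 0 :=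
      mul_nonpos_of_nonneg_of_nonpos hL0 (by linarith)
    linarith
  have h := sideBranch_le_init_of_deriv_nonpos hderΦ hle ht
  simp only [hΦ, integral_same, mul_zero, sub_zero] at h
  linarith

/-- **The `ε`-family with empty side mode and pocket.** If moreover `s_k(0) = z_{k+1}(0) = 0`, then for
every `ε > 0` and `t ∈ [0,s]`, with `Y = s_k(t)² + z_{k+1}(t)²` and `A = (Λ_k/5)∫₀ᵗ x_k⁴`:
`Y ≤ A/ε + ε·e^{ν_{k+1}t}·√Y` (pocket meter p619653 and `z_{k+1} ≤ √Y`). [this file] -/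
theorem sideBranch_capture_eps (hε : 0 < ε₀) (hν : 0 ≤ ν)
    (hcont : ∀ (i : Fin 4) (k : ℤ), Continuous (X i k))
    (hder : ∀ (i : Fin 4) (k : ℤ), ∀ t ∈ Icc (0 : ℝ) s, HasDerivWithinAt (X i k)
      (quadTerm ε₀ sideBranchTable X i k t - ν * (1 + ε₀) ^ ((2 : ℝ) * k) * X i k t)
      (Icc (0 : ℝ) s) t)
    (k : ℤ) (hs0 : X 1 k 0 = 0) (hz0 : X 2 (k + 1) 0 = 0) {ε : ℝ} (hεp : 0 < ε)
    {t : ℝ} (ht : t ∈ Icc (0 : ℝ) s) :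
    X 1 k t ^ 2 + X 2 (k + 1) t ^ 2 ≤
      (1 / ε) * ((1 / 5 : ℝ) * (1 + ε₀) ^ ((5 : ℝ) * k / 2) * ∫ u in (0 : ℝ)..t, X 0 k u ^ 4) +
      ε * (Real.exp (ν * (1 + ε₀) ^ ((2 : ℝ) * ((k + 1 : ℤ) : ℝ)) * t) *
        Real.sqrt (X 1 k t ^ 2 + X 2 (k + 1) t ^ 2)) := by
  have h1 := sideBranch_capture_family hε hν hcont hder k hεp ht
  rw [hs0, hz0] at h1
  have hmeter := sideBranch_pocket_meter hε hν hcont hder k hz0 ht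
  have hE : 0 < Real.exp (ν * (1 + ε₀) ^ ((2 : ℝ) * ((k + 1 : ℤ) : ℝ)) * t) := Real.exp_pos _
  have hzle : X 2 (k + 1) t ≤ Real.sqrt (X 1 k t ^ 2 + X 2 (k + 1) t ^ 2) := by
    calc X 2 (k + 1) t ≤ |X 2 (k + 1) t| := le_abs_self _
      _ = Real.sqrt (X 2 (k + 1) t ^ 2) := (Real.sqrt_sq_eq_abs _).symm
      _ ≤ Real.sqrt (X 1 k t ^ 2 + X 2 (k + 1) t ^ 2) :=
          Real.sqrt_le_sqrt (by nlinarith [sq_nonneg (X 1 k t)])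
  have h2 : (1 / 5 : ℝ) * (1 + ε₀) ^ ((5 : ℝ) * k / 2) * (∫ u in (0 : ℝ)..t, X 1 k u ^ 2) ≤
      Real.exp (ν * (1 + ε₀) ^ ((2 : ℝ) * ((k + 1 : ℤ) : ℝ)) * t) *
        Real.sqrt (X 1 k t ^ 2 + X 2 (k + 1) t ^ 2) :=
    hmeter.trans (mul_le_mul_of_nonneg_left hzle hE.le)
  have h3 := mul_le_mul_of_nonneg_left h2 hεp.le
  nlinarith [h1, h3]

/-- **THE CAPTURE LAW of `α_SB`.** Along a regular solution of the `ν`-viscous `α_SB` lattice on `[0,s]`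
(`ν ≥ 0`, continuous modes; NO sign condition, NO ceiling), for every shell `k` with `s_k(0) = z_{k+1}(0) = 0`
and every `t ∈ [0,s]`, with `Y = s_k(t)² + z_{k+1}(t)²`:
**`Y·√Y ≤ 4·e^{ν_{k+1}t}·(Λ_k/5)·∫₀ᵗ x_k⁴`**, i.e. the energy captured from the chain at shell `k` (parked
in `z_{k+1}` or still in `s_k`) is `½Y ≤ ½(4e^{ν_{k+1}t}(Λ_k/5)∫₀ᵗx_k⁴)^{2/3}`.  (Optimise `ε` in
`sideBranch_capture_eps`.)  This is the rigorous form of the numerics' `z³ ≍ Λ_k∫x_k⁴`. [this file] -/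
theorem sideBranch_capture_law (hε : 0 < ε₀) (hν : 0 ≤ ν)
    (hcont : ∀ (i : Fin 4) (k : ℤ), Continuous (X i k))
    (hder : ∀ (i : Fin 4) (k : ℤ), ∀ t ∈ Icc (0 : ℝ) s, HasDerivWithinAt (X i k)
      (quadTerm ε₀ sideBranchTable X i k t - ν * (1 + ε₀) ^ ((2 : ℝ) * k) * X i k t)
      (Icc (0 : ℝ) s) t)
    (k : ℤ) (hs0 : X 1 k 0 = 0) (hz0 : X 2 (k + 1) 0 = 0) {t : ℝ} (ht : t ∈ Icc (0 : ℝ) s) :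
    (X 1 k t ^ 2 + X 2 (k + 1) t ^ 2) * Real.sqrt (X 1 k t ^ 2 + X 2 (k + 1) t ^ 2) ≤
      4 * Real.exp (ν * (1 + ε₀) ^ ((2 : ℝ) * ((k + 1 : ℤ) : ℝ)) * t) *
        ((1 / 5 : ℝ) * (1 + ε₀) ^ ((5 : ℝ) * k / 2) * ∫ u in (0 : ℝ)..t, X 0 k u ^ 4) := by
  have hb : (0 : ℝ) < 1 + ε₀ := by linarith
  set Y : ℝ := X 1 k t ^ 2 + X 2 (k + 1) t ^ 2 with hY
  set A : ℝ := (1 / 5 : ℝ) * (1 + ε₀) ^ ((5 : ℝ) * k / 2) * ∫ u in (0 : ℝ)..t, X 0 k u ^ 4 with hA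
  set B : ℝ := Real.exp (ν * (1 + ε₀) ^ ((2 : ℝ) * ((k + 1 : ℤ) : ℝ)) * t) with hB
  have hY0 : 0 ≤ Y := by positivity
  have hB0 : 0 < B := Real.exp_pos _
  have hA0 : 0 ≤ A := by
    have hint : 0 ≤ ∫ u in (0 : ℝ)..t, X 0 k u ^ 4 :=
      intervalIntegral.integral_nonneg ht.1 fun u _ => by positivity
    exact mul_nonneg (mul_nonneg (by norm_num) (Real.rpow_nonneg hb.le _)) hint
  have hfam : ∀ ε : ℝ, 0 < ε → Y ≤ (1 / ε) * A + ε * (B * Real.sqrt Y) := fun ε hεp =>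
    sideBranch_capture_eps hε hν hcont hder k hs0 hz0 hεp ht
  set R : ℝ := Real.sqrt Y with hR
  have hR0 : 0 ≤ R := Real.sqrt_nonneg _
  have hRY : R * R = Y := Real.mul_self_sqrt hY0
  -- Case `Y = 0`
  rcases eq_or_lt_of_le hY0 with hY00 | hYpos
  · rw [← hY00]; simp only [zero_mul]; positivity
  have hRpos : 0 < R := Real.sqrt_pos.2 hYpos
  -- Case `A = 0`: then `Y ≤ ε B R` for all `ε`, so `Y = 0` — contradiction
  rcases eq_or_lt_of_le hA0 with hA00 | hApos
  · exfalso
    have h1 := hfam (Y / (2 * B * R)) (by positivity)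
    rw [← hA00, mul_zero, zero_add] at h1
    have h2 : Y / (2 * B * R) * (B * R) = Y / 2 := by
      field_simp
    rw [h2] at h1
    linarith
  -- Generic case: `ε* = √(A/(B R))` gives `Y ≤ 2√(A B R)`, so `Y² ≤ 4ABR`, `Y·R ≤ 4AB`
  set ε : ℝ := Real.sqrt (A / (B * R)) with hεdef
  have hεpos : 0 < ε := Real.sqrt_pos.2 (by positivity)
  have hεsq : ε * ε = A / (B * R) := Real.mul_self_sqrt (by positivity)
  have h1 := hfam ε hεpos
  -- `(1/ε)A = ε B R`
  have hBR : 0 < B * R := by positivity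
  have hA' : A = ε * ε * (B * R) := by
    rw [hεsq]; field_simp
  have h2 : (1 / ε) * A = ε * (B * R) := by
    rw [hA']; field_simp
  rw [h2] at h1
  -- `Y ≤ 2 ε B R` and `(ε B R)² = A B R`
  have h3 : (ε * (B * R)) ^ 2 = A * (B * R) := by
    have : (ε * (B * R)) ^ 2 = (ε * ε) * (B * R) * (B * R) := by ring
    rw [this, hεsq]
    field_simp
  have h4 : Y ^ 2 ≤ 4 * (A * (B * R)) := by
    have h5 : 0 ≤ ε * (B * R) := by positivity
    nlinarith [h1, h3, h5]
  -- divide by `R > 0`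
  have h6 : Y * R * R ≤ 4 * B * A * R := by nlinarith [h4, hRY]
  exact le_of_mul_le_mul_right (by linarith [h6]) hRpos

end Solution

end Summit.NavierStokesRegularity.NavierStokesRegularity.Theorems.SubOnsagerCeiling

end
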